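import Mathlib.Tactic.NormNum.LegendreSymbol
import Summits.BirchSwinnertonDyer.Rank1Residual.F1Sign2.DefiniteMod2WaldspurgerAtTwo
import HarnessLib

/-!
# AN-43 kernel — -an g25's sanity lemma `law → AN-43⁻` (Sketch v5 e18ded699efe069d l.174–178) and REF1-AUDIT §232's BC7 certificates a–h, j
# (`REF1-data/b232/Probe232b.lean` 36c19db7c4144df8 l.158–246 + `Probe232c.lean` 636273547b6b659a l.198–226, l.233–238, VERBATIM up to the namespace
# (`…F1Sign2.ANg25.Kernel` for REF1's `…Cruxes.RankOneAtTwoBigImageOddLocal.REF1_232{,c}`), one typer-added docstring, and BC7-j's two `example`s named as theorems)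
# for `F1Sign2/DefiniteMod2WaldspurgerAtTwo.lean` (typer -ty g20)

CONTENT (all PROVED, no `sorry`, no new `def`): `oddToricPeriodOfSelmerTrivial_of_law` (-an: AN-43 ⟹ its ⟸ half) · BC7-a `not_oddToricPeriod_of_isEmpty` (no Brandt set-up of
discriminant `N` ⟹ `¬ OddToricPeriod W N K`: the ⟸ half ASSERTS existence, the vanishing rows are not junk-provable) · BC7-b `nonempty_setup_of_oddToricPeriod` · BC7-c SIGN
choice-freeness: `evalAtLattice_neg`, `toricPeriod_neg`, `odd_weightedPeriod_neg_iff` (replacing the eigen-line generator `φ` by `−φ` does not change the PARITY of the weighted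
period; the ORBIT choice is NOT certified here — R232a) · BC7-d `rhs_false_of_law_of_vanishingAtTwo`, BC7-e `rhs_false_of_law_of_genusVanishing`, BC7-g `rhs_false_of_law_of_oneModFour`,
BC7-h `rhs_false_of_law_of_oddAp2` — the BRANDT-FREE PREDICTIONS of the typed package (Law ∧ T1⁺ / T1 / T1⁺ᵇ / T1⁺ᵃ ⟹ on the corresponding rows NOT (`Sel₂(W') = 1 ∧ ∏c(W')` odd);
LMFDB / pari columns only, no quaternion arithmetic — the cheapest INDEPENDENT falsifier for -data) · BC7-f `jacobiSym_two_ne_neg_one` (the guard `N = 2` is vacuous: Mathlib's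
`jacobiSym d 2 ∈ {0, 1}`) · BC7-j non-vacuity of T1⁺ᵇ/T1⁺ᵃ's side conditions at `N = 37`, `d = −20` (`sideConditions_thirtySeven_negTwenty`, `jacobiSym_negTwenty_thirtySeven`).
REF1's BC7-i `cover_note : True` (T1⁺ ∩ T1⁺ᵇ consistent at `8 ∣ d`; the cell `N ≡ 3 (mod 4) ∧ 2 ∣ a₂ ∧ 4 ∥ d` correctly left open) is recorded here as text only.
BSD is not proved by this; 23715 is not closed by this.
-/

namespace Summit.BirchSwinnertonDyer.Rank1Residual.F1Sign2.ANg25.Kernel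

open Literature.NumberTheory.Automorphic Literature.NumberTheory.Automorphic.Brandt
open Literature.NumberTheory.EllipticCurves
open Summit.BirchSwinnertonDyer.Rank1Residual.F1Sign2.ANg25

open scoped NumberField nonZeroDivisors

/-- (-an g25, Sketch v5 l.174–178.) Sanity: AN-43 implies its ⟸ half. -/
theorem oddToricPeriodOfSelmerTrivial_of_law (h : DefiniteMod2WaldspurgerLaw) :
    OddToricPeriodOfSelmerTrivial := by
  intro W _ _ N hN hc hr hs hΔ K _ _ d hK hd hd4 hj W' _ _ C hC hsel htam
  exact (h W N hN hc hr hs hΔ K d hK hd hd4 hj W' C hC).mpr ⟨hsel, htam⟩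

/-- BC7-a (docstring claim «with no set-up … the predicate is `False`», kernel): no Brandt set-up of
discriminant `N` ⇒ `¬ OddToricPeriod W N K`.  In particular the `⟸` half (`OddToricPeriodOfSelmerTrivial`)
ASSERTS the existence of a set-up + eigen-line + Gross point whenever its arithmetic hypotheses are met —
it is not junk-provable (the tree constructs no `Brandt.XiSetup`). -/
theorem not_oddToricPeriod_of_isEmpty (W : WeierstrassCurve ℚ) [W.IsGloballyMinimal] (N : ℕ)
    (K : Type) [Field K] [NumberField K] (h : IsEmpty (Brandt.XiSetup 1 N)) :
    ¬ OddToricPeriod W N K := by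
  rintro ⟨S, -⟩
  exact h.elim S

/-- BC7-b (any proof of `OddToricPeriod` yields a set-up: converse bookkeeping of BC7-a). -/
theorem nonempty_setup_of_oddToricPeriod (W : WeierstrassCurve ℚ) [W.IsGloballyMinimal] (N : ℕ)
    (K : Type) [Field K] [NumberField K] (h : OddToricPeriod W N K) : Nonempty (Brandt.XiSetup 1 N) := by
  obtain ⟨S, -⟩ := h
  exact ⟨S⟩

section sign
variable {D : Type} [Ring D] [Algebra ℚ D] {K : Type} [Field K] [NumberField K]

omit [Algebra ℚ D] in
/-- `evalAtLattice` is odd in `φ`. -/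
theorem evalAtLattice_neg {O : Submodule ℤ D} (φ : Brandt.ClassSet O → ℤ) (X : Submodule ℤ D) :
    Brandt.evalAtLattice (fun c => -φ c) X = -Brandt.evalAtLattice φ X := by
  by_cases hX : X ∈ Brandt.rightIdeals O
  · rw [Brandt.evalAtLattice_of_mem _ hX, Brandt.evalAtLattice_of_mem _ hX]
  · rw [Brandt.evalAtLattice_of_not_mem _ hX, Brandt.evalAtLattice_of_not_mem _ hX, neg_zero]

/-- BC7-c (SIGN choice-freeness, kernel): the toric period is odd in `φ`, so replacing the eigen-line generator
`φ` by `-φ` (the only other generator, `Brandt.eq_or_eq_neg_of_span_eq`) does not change the PARITY of the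
weighted period.  (The ORBIT choice — which of the two `Pic(𝓞_K)`-orbits of Gross points — is NOT certified
here: it rests on `T_N φ = ± φ`, a consequence of multiplicity one at prime level that the `eigenLattice`
condition, which only binds `p ∤ N`, does not state; see R232a.) -/
theorem toricPeriod_neg (O : Submodule ℤ D) (ψ : K →ₐ[ℚ] D) (I : Submodule ℤ D)
    (g : Brandt.ClassSet O → ℤ) :
    Brandt.toricPeriod O ψ I (fun c => -g c) = -Brandt.toricPeriod O ψ I g := by
  rw [Brandt.toricPeriod_def, Brandt.toricPeriod_def, ← Finset.sum_neg_distrib]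
  exact Finset.sum_congr rfl fun 𝔞 _ => evalAtLattice_neg g _

/-- (Typer-added docstring.) BC7-c, weighted form: the parity of the WEIGHTED toric period `Σ_𝔞 (w·φ)` is unchanged under `φ ↦ −φ`. -/
theorem odd_weightedPeriod_neg_iff (O : Submodule ℤ D) (ψ : K →ₐ[ℚ] D) (I : Submodule ℤ D)
    (w : Brandt.ClassSet O → ℕ) (φ : Brandt.ClassSet O → ℤ) :
    Odd (Brandt.toricPeriod O ψ I (fun c => (w c : ℤ) * (-φ) c)) ↔
      Odd (Brandt.toricPeriod O ψ I (fun c => (w c : ℤ) * φ c)) := by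
  have : (fun c => (w c : ℤ) * (-φ) c) = fun c => -((fun c => (w c : ℤ) * φ c) c) := by
    funext c; simp [mul_neg]
  rw [this, toricPeriod_neg, odd_neg]

end sign

/-- BC7-d (a BRANDT-FREE PREDICTION of the pair Law ∧ T1⁺, kernel): for `8 ∣ d` the law's right-hand side must
fail — i.e. among globally minimal models `W'` of the twist `W^{(d)}` (W of prime conductor `N`, analytic rank 0,
`S₃`-image at 2, `Δ < 0`; `K` of discriminant `d < -4`, `N` inert, `8 ∣ d`): NOT (trivial `2`-Selmer ∧ odd
Tamagawa product).  This is checkable by -data from LMFDB columns alone (no quaternion arithmetic) — the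
cheapest independent falsifier of the typed pair. -/
theorem rhs_false_of_law_of_vanishingAtTwo (hL : DefiniteMod2WaldspurgerLaw) (hT : ToricPeriodVanishingAtTwo)
    (W : WeierstrassCurve ℚ) [W.IsElliptic] [W.IsGloballyMinimal] (N : ℕ)
    (hN : N.Prime) (hc : W.conductorNorm ℤ = N) (hr : W.analyticRank = 0)
    (hs : W.HasSurjectiveModNGaloisRep 2) (hΔ : W.Δ < 0)
    (K : Type) [Field K] [NumberField K] (d : ℤ) (hK : IsImaginaryQuadratic K)
    (hd : NumberField.discr K = d) (hd4 : d < -4) (hj : jacobiSym d N = -1) (h8 : (8 : ℤ) ∣ d)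
    (W' : WeierstrassCurve ℚ) [W'.IsElliptic] [W'.IsGloballyMinimal] (C : WeierstrassCurve.VariableChange ℚ)
    (hC : C • W' = W.quadraticTwist (d : ℚ)) :
    ¬ (Nat.card (W'.selmerGroup 2) = 1 ∧ Odd W'.tamagawaProduct) := by
  intro hR
  exact hT W N hN hc hΔ K d hK hd hj h8 ((hL W N hN hc hr hs hΔ K d hK hd hd4 hj W' C hC).mpr hR)

/-- BC7-e (T1 and the law jointly, kernel): under the law, T1's genus condition forces the RHS to fail too —
the docstring's «BSD-consistency: each such p has c_p(W^{(d)}) = 2» is the arithmetic shadow (even Tamagawa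
product or non-trivial Selmer). -/
theorem rhs_false_of_law_of_genusVanishing (hL : DefiniteMod2WaldspurgerLaw) (hG : ToricPeriodGenusVanishing)
    (W : WeierstrassCurve ℚ) [W.IsElliptic] [W.IsGloballyMinimal] (N : ℕ)
    (hN : N.Prime) (hc : W.conductorNorm ℤ = N) (hr : W.analyticRank = 0)
    (hs : W.HasSurjectiveModNGaloisRep 2) (hΔ : W.Δ < 0)
    (K : Type) [Field K] [NumberField K] (d : ℤ) (hK : IsImaginaryQuadratic K)
    (hd : NumberField.discr K = d) (hd4 : d < -4) (hj : jacobiSym d N = -1)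
    (hp : ∃ p : ℕ, p.Prime ∧ p ≠ 2 ∧ (p : ℤ) ∣ d ∧ jacobiSym (-(N : ℤ)) p = -1)
    (W' : WeierstrassCurve ℚ) [W'.IsElliptic] [W'.IsGloballyMinimal] (C : WeierstrassCurve.VariableChange ℚ)
    (hC : C • W' = W.quadraticTwist (d : ℚ)) :
    ¬ (Nat.card (W'.selmerGroup 2) = 1 ∧ Odd W'.tamagawaProduct) := by
  intro hR
  exact hG W N hN hc K d hK hd hd4 hj hp ((hL W N hN hc hr hs hΔ K d hK hd hd4 hj W' C hC).mpr hR)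

/-- BC7-f (GUARD `N = 2` is vacuous, kernel): `jacobiSym d 2 ≠ -1` for every `d` (Mathlib's `jacobiSym` at the
even modulus `2` is the Legendre-type character of `ZMod 2`, valued in `{0, 1}`), so every decl is vacuous at
`N = 2` — harmless (no curve has conductor 2), recorded so nobody reads content into that case. -/
theorem jacobiSym_two_ne_neg_one (d : ℤ) : jacobiSym d 2 ≠ -1 := by
  rw [← jacobiSym.legendreSym.to_jacobiSym, legendreSym]
  generalize (d : ZMod 2) = x
  revert x
  decide

/-- BC7-g (Brandt-free prediction of Law ∧ T1⁺ᵇ, kernel): on the law's frame with `N ≡ 1 (mod 4)`, `4 ∣ d`,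
`d < -8`, the BSD-side right-hand side must FAIL for every globally minimal model of the twist. -/
theorem rhs_false_of_law_of_oneModFour (hL : DefiniteMod2WaldspurgerLaw) (hT : ToricPeriodEvenOfOneModFour)
    (W : WeierstrassCurve ℚ) [W.IsElliptic] [W.IsGloballyMinimal] (N : ℕ)
    (hN : N.Prime) (hc : W.conductorNorm ℤ = N) (h4 : N % 4 = 1) (hr : W.analyticRank = 0)
    (hs : W.HasSurjectiveModNGaloisRep 2) (hΔ : W.Δ < 0)
    (K : Type) [Field K] [NumberField K] (d : ℤ) (hK : IsImaginaryQuadratic K)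
    (hd : NumberField.discr K = d) (hd8 : d < -8) (hj : jacobiSym d N = -1) (h4d : (4 : ℤ) ∣ d)
    (W' : WeierstrassCurve ℚ) [W'.IsElliptic] [W'.IsGloballyMinimal] (C : WeierstrassCurve.VariableChange ℚ)
    (hC : C • W' = W.quadraticTwist (d : ℚ)) :
    ¬ (Nat.card (W'.selmerGroup 2) = 1 ∧ Odd W'.tamagawaProduct) := by
  intro hR
  have hd4 : d < -4 := by omega
  exact hT W N hN hc h4 K d hK hd hd8 hj h4d ((hL W N hN hc hr hs hΔ K d hK hd hd4 hj W' C hC).mpr hR)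

/-- BC7-h (Brandt-free prediction of Law ∧ T1⁺ᵃ, kernel): on the law's frame with `a₂(W)` odd and `4 ∥ d`,
the right-hand side must FAIL. -/
theorem rhs_false_of_law_of_oddAp2 (hL : DefiniteMod2WaldspurgerLaw) (hT : ToricPeriodEvenOfOddAp2)
    (W : WeierstrassCurve ℚ) [W.IsElliptic] [W.IsGloballyMinimal] (N : ℕ)
    (hN : N.Prime) (hc : W.conductorNorm ℤ = N) (ha : Odd (W.frobeniusTrace 2)) (hr : W.analyticRank = 0)
    (hs : W.HasSurjectiveModNGaloisRep 2) (hΔ : W.Δ < 0)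
    (K : Type) [Field K] [NumberField K] (d : ℤ) (hK : IsImaginaryQuadratic K)
    (hd : NumberField.discr K = d) (hd4 : d < -4) (hj : jacobiSym d N = -1) (h4d : (4 : ℤ) ∣ d)
    (hn8 : ¬ (8 : ℤ) ∣ d)
    (W' : WeierstrassCurve ℚ) [W'.IsElliptic] [W'.IsGloballyMinimal] (C : WeierstrassCurve.VariableChange ℚ)
    (hC : C • W' = W.quadraticTwist (d : ℚ)) :
    ¬ (Nat.card (W'.selmerGroup 2) = 1 ∧ Odd W'.tamagawaProduct) := by
  intro hR
  exact hT W N hN hc ha K d hK hd hd4 hj h4d hn8 ((hL W N hN hc hr hs hΔ K d hK hd hd4 hj W' C hC).mpr hR)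

/-- BC7-j (non-vacuity of the new side conditions, kernel arithmetic; REF1's two `example`s, named by the typer): the row `N = 37`, `d = -20` satisfies
`N % 4 = 1`, `d < -8`, `4 ∣ d`, `¬ 8 ∣ d`. -/
theorem sideConditions_thirtySeven_negTwenty : (37 : ℕ) % 4 = 1 ∧ (-20 : ℤ) < -8 ∧ (4 : ℤ) ∣ (-20) ∧ ¬ (8 : ℤ) ∣ (-20) := by decide

/-- BC7-j (continued): `jacobiSym (-20) 37 = -1` (`N = 37` is inert in `ℚ(√-20) = ℚ(√-5)`), by `norm_num`'s Jacobi extension. -/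
theorem jacobiSym_negTwenty_thirtySeven : jacobiSym (-20) 37 = -1 := by norm_num

/-- (-an g26, Sketch v6/v7, VERBATIM.) Sanity (v6): the complete `8 ∣ d` statement implies the v5 one on `d < -8`. -/
theorem toricPeriodVanishingAtTwo_of_eightDvd (h : ToricPeriodEvenOfEightDvd)
    (W : WeierstrassCurve ℚ) [W.IsElliptic] [W.IsGloballyMinimal] (N : ℕ)
    (hN : N.Prime) (hc : W.conductorNorm ℤ = N)
    (K : Type) [Field K] [NumberField K] (d : ℤ) (hK : IsImaginaryQuadratic K)
    (hd : NumberField.discr K = d) (hd8 : d < -8) (hj : jacobiSym d N = -1) (h8 : (8 : ℤ) ∣ d) :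
    ¬ OddToricPeriod W N K :=
  h W N hN hc K d hK hd hd8 hj h8

/-- (-an g26, crux workfile v8.1, VERBATIM.) Sanity (v8): the criterion form (H) contains the even direction (H⁻) on its regime. -/
theorem toricPeriodEven_of_criterion (h : OddToricPeriodCriterion)
    (W : WeierstrassCurve ℚ) [W.IsElliptic] [W.IsGloballyMinimal] (N : ℕ)
    (hN : N.Prime) (hc : W.conductorNorm ℤ = N) (hr : W.analyticRank = 0) (hS : Nat.card (W.selmerGroup 2) = 1)
    (hρ : W.HasSurjectiveModNGaloisRep 2) (hΔ : IsSquare (-(N : ℚ) * W.Δ))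
    (K : Type) [Field K] [NumberField K] (d : ℤ) (hK : IsImaginaryQuadratic K)
    (hd : NumberField.discr K = d) (hd4 : d < -4) (hj : jacobiSym d N = -1)
    (p : ℕ) (hp : p.Prime) (hp2 : p ≠ 2) (hpd : (p : ℤ) ∣ d) (hap : Even (W.frobeniusTrace p)) :
    ¬ OddToricPeriod W N K := by
  intro hodd
  have hcrit := (h W N hN hc hr hS hρ hΔ K d hK hd hd4 hj).mp hodd
  exact (Int.not_even_iff_odd.mpr (hcrit.1 p hp hp2 hpd)) hap

/-- (-an g26, crux workfile v8.1, VERBATIM.) Sanity (v8): (H) and (H⁼) — two criterion fields have the same parity. -/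
theorem toricParityConstant_of_criterion (h : OddToricPeriodCriterion)
    (W : WeierstrassCurve ℚ) [W.IsElliptic] [W.IsGloballyMinimal] (N : ℕ)
    (hN : N.Prime) (hc : W.conductorNorm ℤ = N) (hr : W.analyticRank = 0) (hS : Nat.card (W.selmerGroup 2) = 1)
    (hρ : W.HasSurjectiveModNGaloisRep 2) (hΔ : IsSquare (-(N : ℚ) * W.Δ))
    (K₁ : Type) [Field K₁] [NumberField K₁] (K₂ : Type) [Field K₂] [NumberField K₂] (d₁ d₂ : ℤ)
    (hK₁ : IsImaginaryQuadratic K₁) (hK₂ : IsImaginaryQuadratic K₂)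
    (hd₁ : NumberField.discr K₁ = d₁) (hd₂ : NumberField.discr K₂ = d₂) (h₁ : d₁ < -4) (h₂ : d₂ < -4)
    (hj₁ : jacobiSym d₁ N = -1) (hj₂ : jacobiSym d₂ N = -1) (hc₁ : ToricCriterion W d₁) (hc₂ : ToricCriterion W d₂) :
    OddToricPeriod W N K₁ ↔ OddToricPeriod W N K₂ := by
  rw [h W N hN hc hr hS hρ hΔ K₁ d₁ hK₁ hd₁ h₁ hj₁, h W N hN hc hr hS hρ hΔ K₂ d₂ hK₂ hd₂ h₂ hj₂]
  exact ⟨fun _ => hc₂, fun _ => hc₁⟩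

/-- (-an g26, crux workfile v8.1, VERBATIM.) Sanity (v8): the repaired (D1)ʳ is the ⟸ half of the dictionary. -/
theorem modTwoToricNonvanishingR_of_iff (h : ModTwoToricNonvanishingIffOddLValue) : ModTwoToricNonvanishingR := by
  intro W _ _ N hN hc hr hS hρ hΔ k _ _ hk hdisc S _ φ ψ I hx hφ hE
  exact (h W N hN hc hρ hΔ k hk hdisc S φ ψ I hx hφ hE).mpr ⟨hr, hS⟩

/-- The merged REF2 form is the conjunction of the two typed 2-adic rungs (pure logic: split on `8 ∣ d`). -/
theorem toricPeriodEvenOfOddApTwoEvenDisc_of (h4 : ToricPeriodEvenOfOddAp2) (h8 : ToricPeriodEvenOfEightDvd) :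
    ToricPeriodEvenOfOddApTwoEvenDisc := by
  intro W _ _ N hN hc ha2 K _ _ d hK hdisc hd hj h4d
  by_cases h8d : (8 : ℤ) ∣ d
  · exact h8 W N hN hc K d hK hdisc hd hj h8d
  · exact h4 W N hN hc ha2 K d hK hdisc (by omega) hj h4d h8d

end Summit.BirchSwinnertonDyer.Rank1Residual.F1Sign2.ANg25.Kernel
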